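import Literature.NumberTheory.LFunctions.Zhang2022.Section18Margin232D
import HarnessLib

/-!
# Zhang (2022), §9/§18 numerics — the two readings of `𝔠₂` differ by a CERTIFIED `0.00782…`, far below the deficit

Topic `Literature/NumberTheory/LFunctions/Zhang2022` (Landau–Siegel audit tree; verdict-neutral).
Y. Zhang, *Discrete mean estimates and the Landau–Siegel zero*, arXiv:2211.02515v1 (2022)
[Zhang2022LandauSiegel] — **an unrefereed manuscript under adjudication.**

LS rescue (D-0124) catalogue row LSR-803 (director R2 / bed node M-03, (9.7)–(9.8)) carried the token
`frakc2_re_ne_frakc2c_re` as a DESK certificate: the printed-prefactor reading `𝔠₂` (prefactor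
`((0.504)(0.498)π)⁻¹` of (9.5)/(9.6)) and the definition reading `𝔠₂ᶜ` (prefactor `((0.5)(0.498)π)⁻¹`,
from `P₂ = P^{0.5}T^{-10}`) are different numbers. This file makes it a KERNEL fact from the landed
brackets `frakc2_re_bounds` / `frakc2c_re_bounds` (`Section18Certificate`): `𝔠₂ᶜ < 𝔠₂`, the gap lies in
`(0.0078209, 0.0078221)`, and the gap is smaller than the amount by which EITHER reading misses the §18 margin
`< 0.001` (the favourable total already exceeds `0.05`, `margin232D_total_gt`) — so the (9.7) prefactor
reading is NOT load-bearing, in the kernel. Nothing here is a claim about `L`-functions.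
«The programme SEARCHES and TYPES; no claim about Landau–Siegel zeros, Theorems 1–2 of arXiv:2211.02515 or a
repaired Margin232 until a kernel theorem says so.»

## References

* Y. Zhang, arXiv:2211.02515v1 (2022), §9 (9.5)–(9.8) p. 19; §18 p. 99; §2 (2.32).
  [cite: Zhang2022LandauSiegel, §9 (9.5)–(9.8); §18 p. 99]
-/

noncomputable section

namespace Literature.NumberTheory.LFunctions.Zhang2022

/-- **`𝔠₂ᶜ < 𝔠₂` strictly** (`6.987092… < 6.9949139…`): the two prefactor readings of (9.5)/(9.6) give
different constants (strict form of `frakc2c_re_le_frakc2_re`). [cite: Zhang2022LandauSiegel, §9 (9.5)–(9.7)] -/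
theorem frakc2c_re_lt_frakc2_re : frakc2c.re < frakc2.re := by
  have h2 := frakc2_re_bounds.1
  have h2c := frakc2c_re_bounds.2
  linarith

/-- **The desk certificate of LSR-803, in the kernel**: `Re 𝔠₂ ≠ Re 𝔠₂ᶜ`.
[cite: Zhang2022LandauSiegel, §9 (9.5)–(9.7)] -/
theorem frakc2_re_ne_frakc2c_re : frakc2.re ≠ frakc2c.re :=
  (ne_of_lt frakc2c_re_lt_frakc2_re).symm

/-- **Certified gap between the readings**: `0.0078209 < Re 𝔠₂ − Re 𝔠₂ᶜ < 0.0078221`.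
[cite: Zhang2022LandauSiegel, §9 (9.5)–(9.7)] -/
theorem frakc2_re_sub_frakc2c_re_bounds :
    (0.0078209 : ℝ) < frakc2.re - frakc2c.re ∧ frakc2.re - frakc2c.re < 0.0078221 := by
  obtain ⟨h2l, h2u⟩ := frakc2_re_bounds
  obtain ⟨h2cl, h2cu⟩ := frakc2c_re_bounds
  constructor <;> linarith

/-- **The reading choice is not load-bearing**: the gap `Re 𝔠₂ − Re 𝔠₂ᶜ` is smaller than the deficit of the
FAVOURABLE reading against the §18 margin, `(𝔠₁ + 𝔠₂ᶜ + 2(Re 𝔠₃ᴰ + 10⁻⁵)) − 0.001` (which exceeds `0.049`);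
both readings are refuted as typed (`not_margin232D`, `not_margin232D_with_of_le`).
[cite: Zhang2022LandauSiegel, §18 p. 99; §2 (2.32)] -/
theorem frakc2_readings_gap_lt_deficit :
    frakc2.re - frakc2c.re < (frakc1.re + frakc2c.re + 2 * (frakc3D.re + 1e-5)) - 0.001 := by
  have hgap := frakc2_re_sub_frakc2c_re_bounds.2
  have htot := margin232D_total_gt
  linarith

end Literature.NumberTheory.LFunctions.Zhang2022
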